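import Mathlib
import Summits.NavierStokesRegularity.NavierStokesRegularity.Theorems.ThreadingFluxHorizonTowerQuadraticGeneratorChart
import HarnessLib

/-!
# Crux `PoloidalLiouville` (stmt-NavierStokesRegularity-1222), crux idea «horizon-threading-tower» (ns-idea-15):
# THE QUADRATIC GENERATOR, V — the octic harmonic projection `π₈(L⁴)`

Support file (`--supports stmt-NavierStokesRegularity-1222`, helper; cell `ns-wall-extremal`, width hand ns-wall-eng-3 g5; 0 kit), toward
THM F «the finite tower `{2, 6, 8}` is coaxially zonal at order one» (top pair `(6, 8) = 2·(3, 4)`: the top shells are `c₁·π₆(L³)` and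
`c₂·π₈(L⁴)` for one harmonic quadratic `L = xᵀQx`).

* `genC = 2145 L⁴ − 3432 ρL²M + 528 ρ²M² + 660 τρ²L² + 768 δρ³L − 144 τρ³M + 4 τ²ρ⁴ = 2145 · π₈(L⁴)` — HARMONIC (`lapP_genC`),
  homogeneous of degree `8`, `chartT genC = 2145 · (chartT L)⁴` (the chart is multiplicative modulo `ρ`), the injectivity consequence
  (`𝓗₈ ∋ H`, `chartT H = c·(chartT L)⁴ ⇒ H = (c/2145)·genC`), coefficient maps and scaling (`genC(w•Q) = w⁴ genC(Q)`);
* the missing gradient pairing `∇M·∇M = 2τM + 4δL` (Cayley–Hamilton, `Q⁴ = (τ/2)Q² + δQ`) and right-handed Leibniz rules for `dotP`.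

HONEST LABEL: polynomial identities about one crux idea's typed objects; no Prop of the sketch is closed here; `HorizonTowerZonality`
(general towers), `PoloidalLiouville` (1222) OPEN; NS regularity NOT proved.  [folklore]
-/

-- the summit and its single sub-problem share the name (CONVENTIONS §1)
set_option linter.dupNamespace false

noncomputable section

open MvPolynomial Complex

namespace Summit.NavierStokesRegularity.NavierStokesRegularity.Theorems.PoloidalLiouville.HorizonTower.Zonal

section Generic

variable {R : Type*} [CommRing R]

/-- `C = 2145 · π₈(L⁴)`, the harmonic projection of the fourth power of the generator (integer normalisation). -/
def genC (a b d e f : R) : MvPolynomial (Fin 3) R :=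
  C 2145 * genL a b d e f ^ 4 - C 3432 * normSq * genL a b d e f ^ 2 * genM a b d e f
    + C 528 * normSq ^ 2 * genM a b d e f ^ 2 + C (660 * genTau a b d e f) * normSq ^ 2 * genL a b d e f ^ 2
    + C (768 * genDelta a b d e f) * normSq ^ 3 * genL a b d e f - C (144 * genTau a b d e f) * normSq ^ 3 * genM a b d e f
    + C (4 * genTau a b d e f ^ 2) * normSq ^ 4

/-! ### Right-handed Leibniz rules for `dotP` -/

/-- `dotP` is additive on the right. [folklore] -/
theorem dotP_add_right (r p q : MvPolynomial (Fin 3) R) : dotP r (p + q) = dotP r p + dotP r q := by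
  rw [dotP_comm, dotP_add_left, dotP_comm p, dotP_comm q]

/-- `dotP` of a difference on the right. [folklore] -/
theorem dotP_sub_right (r p q : MvPolynomial (Fin 3) R) : dotP r (p - q) = dotP r p - dotP r q := by
  rw [dotP_comm, dotP_sub_left, dotP_comm p, dotP_comm q]

/-- `dotP` commutes with constants on the right. [folklore] -/
theorem dotP_C_mul_right (c : R) (r p : MvPolynomial (Fin 3) R) : dotP r (C c * p) = C c * dotP r p := by
  rw [dotP_comm, dotP_C_mul_left, dotP_comm p]

/-- Leibniz rule for `dotP` on the right. [folklore] -/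
theorem dotP_mul_right (r p q : MvPolynomial (Fin 3) R) : dotP r (p * q) = p * dotP r q + q * dotP r p := by
  rw [dotP_comm, dotP_mul_left, dotP_comm q, dotP_comm p]

/-- Constants have zero gradient (left). [folklore] -/
theorem dotP_C_left (c : R) (p : MvPolynomial (Fin 3) R) : dotP (C c) p = 0 := by
  simp only [dotP, pderiv_C, zero_mul, add_zero]

/-- Constants have zero gradient (right). [folklore] -/
theorem dotP_C_right (p : MvPolynomial (Fin 3) R) (c : R) : dotP p (C c) = 0 := by
  rw [dotP_comm, dotP_C_left]

/-- Constants have zero Laplacian. [folklore] -/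
theorem lapP_C' (c : R) : lapP (C c : MvPolynomial (Fin 3) R) = 0 := by
  simp only [lapP, pderiv_C, map_zero, add_zero]

variable (a b d e f : R)

/-! ### The remaining gradient pairings -/

/-- `∇ρ·∇L = 4L`. [folklore] -/
theorem dotP_normSq_genL : dotP normSq (genL a b d e f) = C 4 * genL a b d e f := by
  rw [dotP_comm, dotP_genL_normSq]

/-- `∇ρ·∇M = 4M`. [folklore] -/
theorem dotP_normSq_genM : dotP normSq (genM a b d e f) = C 4 * genM a b d e f := by
  rw [dotP_comm, dotP_genM_normSq]

/-- `∇M·∇L = 2τ L + 4δ ρ`. [folklore] -/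
theorem dotP_genM_genL : dotP (genM a b d e f) (genL a b d e f)
    = C (2 * genTau a b d e f) * genL a b d e f + C (4 * genDelta a b d e f) * normSq := by
  rw [dotP_comm, dotP_genL_genM]

/-- **Cayley–Hamilton, second pairing**: `∇M·∇M = 4 xᵀQ⁴x = 2τ M + 4δ L`. [folklore] -/
theorem dotP_genM_genM : dotP (genM a b d e f) (genM a b d e f)
    = C (2 * genTau a b d e f) * genM a b d e f + C (4 * genDelta a b d e f) * genL a b d e f := by
  rw [dotP, pderiv_zero_genM, pderiv_one_genM, pderiv_two_genM]
  simp only [genL, genM, genS0, genS1, genS2, genQ0, genQ1, genQ2, genTau, genDelta, map_ofNat, map_add, map_mul, map_sub,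
    map_neg, map_pow]
  ring

/-! ### Harmonicity and homogeneity of `C` -/

/-- ★ **`C = 2145 · π₈(L⁴)` IS HARMONIC.** [folklore] -/
theorem lapP_genC : lapP (genC a b d e f) = 0 := by
  unfold genC
  simp only [pow_succ, pow_zero, one_mul, lapP_add, lapP_sub, lapP_mul, lapP_C', lapP_genL, lapP_genM, lapP_normSq,
    dotP_mul_left, dotP_mul_right, dotP_C_left, dotP_genL_genL, dotP_genL_genM, dotP_genM_genM, dotP_normSq_genL,
    dotP_normSq_genM, dotP_normSq_normSq, mul_zero, add_zero, zero_add]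
  simp only [map_ofNat, map_mul]
  ring

/-- `C` is homogeneous of degree eight. [folklore] -/
theorem isHomogeneous_genC : (genC a b d e f).IsHomogeneous 8 := by
  have hL := isHomogeneous_genL a b d e f
  have hM := isHomogeneous_genM a b d e f
  have hρ : (normSq : MvPolynomial (Fin 3) R).IsHomogeneous 2 := isHomogeneous_normSq
  have h1 : (C 2145 * genL a b d e f ^ 4 : MvPolynomial (Fin 3) R).IsHomogeneous 8 := (hL.pow 4).C_mul _
  have h2 : (C 3432 * normSq * genL a b d e f ^ 2 * genM a b d e f : MvPolynomial (Fin 3) R).IsHomogeneous 8 := by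
    rw [mul_assoc, mul_assoc]; exact (hρ.mul ((hL.pow 2).mul hM)).C_mul _
  have h3 : (C 528 * normSq ^ 2 * genM a b d e f ^ 2 : MvPolynomial (Fin 3) R).IsHomogeneous 8 := by
    rw [mul_assoc]; exact ((hρ.pow 2).mul (hM.pow 2)).C_mul _
  have h4 : (C (660 * genTau a b d e f) * normSq ^ 2 * genL a b d e f ^ 2 : MvPolynomial (Fin 3) R).IsHomogeneous 8 := by
    rw [mul_assoc]; exact ((hρ.pow 2).mul (hL.pow 2)).C_mul _
  have h5 : (C (768 * genDelta a b d e f) * normSq ^ 3 * genL a b d e f : MvPolynomial (Fin 3) R).IsHomogeneous 8 := by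
    rw [mul_assoc]; exact ((hρ.pow 3).mul hL).C_mul _
  have h6 : (C (144 * genTau a b d e f) * normSq ^ 3 * genM a b d e f : MvPolynomial (Fin 3) R).IsHomogeneous 8 := by
    rw [mul_assoc]; exact ((hρ.pow 3).mul hM).C_mul _
  have h7 : (C (4 * genTau a b d e f ^ 2) * normSq ^ 4 : MvPolynomial (Fin 3) R).IsHomogeneous 8 := (hρ.pow 4).C_mul _
  unfold genC
  exact (((((h1.sub h2).add h3).add h4).add h5).sub h6).add h7

/-! ### Coefficient maps and scaling -/

variable {S : Type*} [CommRing S] (φ : R →+* S)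

/-- `C` commutes with coefficient maps. [folklore] -/
theorem map_genC : map φ (genC a b d e f) = genC (φ a) (φ b) (φ d) (φ e) (φ f) := by
  simp only [genC, genL, genM, genQ0, genQ1, genQ2, genTau, genDelta, normSq, map_add, map_sub, map_mul, map_pow, map_neg,
    map_X, map_C, map_ofNat]

/-- `C(w•Q) = w⁴ C(Q)`. [folklore] -/
theorem genC_smul (w : R) : genC (w * a) (w * b) (w * d) (w * e) (w * f) = C (w ^ 4) * genC a b d e f := by
  simp only [genC, genL, genM, genQ0, genQ1, genQ2, genTau, genDelta, map_mul, map_add, map_pow, map_sub, map_neg,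
    map_ofNat]
  ring

end Generic

/-! ### Null-cone chart of `C` -/

section Chart

variable (a b d e f : ℂ)

/-- ★ `chartT C = 2145 · (chartT L)⁴` (`C ≡ 2145 L⁴` on the null cone). [folklore] -/
theorem chartT_genC : chartT (genC a b d e f) = Polynomial.C 2145 * chartT (genL a b d e f) ^ 4 := by
  unfold genC
  simp only [chartT_add, chartT_sub, chartT_mul, chartT_C, chartT_pow, chartT_normSq, zero_pow two_ne_zero,
    zero_pow (by norm_num : (3 : ℕ) ≠ 0), zero_pow (by norm_num : (4 : ℕ) ≠ 0), zero_mul, mul_zero, sub_zero, add_zero]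

/-- ★ **INJECTIVITY CONSEQUENCE, degree 8**: a complex solid harmonic `H ∈ 𝓗₈` with `chartT H = c · (chartT L)⁴` is `(c/2145) · C`.
[folklore] -/
theorem eq_C_mul_genC_of_chartT_eq {H : MvPolynomial (Fin 3) ℂ} (hH : H.IsHomogeneous 8) (hlap : lapP H = 0) {c : ℂ}
    (hc : chartT H = Polynomial.C c * chartT (genL a b d e f) ^ 4) : H = C (c / 2145) * genC a b d e f := by
  have h0 : H - C (c / 2145) * genC a b d e f = 0 := by
    refine eq_zero_of_chartT_eq_zero (hH.sub ((isHomogeneous_genC a b d e f).C_mul _)) ?_ ?_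
    · rw [lapP_sub, lapP_C_mul, lapP_genC, hlap, mul_zero, sub_zero]
    · rw [chartT_sub, chartT_mul, chartT_C, chartT_genC, hc, ← mul_assoc, ← Polynomial.C_mul,
        div_mul_cancel₀ c (by norm_num : (2145 : ℂ) ≠ 0), sub_self]
  exact sub_eq_zero.mp h0

end Chart

/-! ### Reality of the generator from TWO consecutive powers -/

/-- ★ **REALITY OF THE GENERATOR, TWO-POWER FORM.**  If non-zero REAL polynomials `P, P'` are `c · B(Q)` and `c' · C(Q)` over `ℂ`
(`B = 77·π₆(L³)`, `C = 2145·π₈(L⁴)`) for one complex traceless symmetric `Q`, then `Q = w • Q'` with `Q'` REAL (on the null cone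
`(chartT L̄)³ ∝ (chartT L)³` and `(chartT L̄)⁴ ∝ (chartT L)⁴`, hence `chartT L̄ ∝ chartT L` without extracting roots). [folklore] -/
theorem exists_real_gen_of_map_eq_C_mul_genB_genC {P P' : MvPolynomial (Fin 3) ℝ} (hP : P ≠ 0) (hP' : P' ≠ 0)
    {a b d e f c c' : ℂ} (h : map (algebraMap ℝ ℂ) P = C c * genB a b d e f)
    (h' : map (algebraMap ℝ ℂ) P' = C c' * genC a b d e f) :
    ∃ (w : ℂ) (a' b' d' e' f' : ℝ), a = w * a' ∧ b = w * b' ∧ d = w * d' ∧ e = w * e' ∧ f = w * f' := by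
  set σ := starRingEnd ℂ with hσ
  have hc : c ≠ 0 := by
    rintro rfl
    rw [C_0, zero_mul, map_eq_zero_iff _ (map_injective (algebraMap ℝ ℂ) (RCLike.ofReal_injective))] at h
    exact hP h
  have hc' : c' ≠ 0 := by
    rintro rfl
    rw [C_0, zero_mul, map_eq_zero_iff _ (map_injective (algebraMap ℝ ℂ) (RCLike.ofReal_injective))] at h'
    exact hP' h'
  -- conjugate both identities
  have hconj : C c * genB a b d e f = C (σ c) * genB (σ a) (σ b) (σ d) (σ e) (σ f) := by
    have := congrArg (map σ) h
    rw [map_conj_map_ofReal, h, map_mul, map_C, map_genB] at this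
    exact this
  have hconj' : C c' * genC a b d e f = C (σ c') * genC (σ a) (σ b) (σ d) (σ e) (σ f) := by
    have := congrArg (map σ) h'
    rw [map_conj_map_ofReal, h', map_mul, map_C, map_genC] at this
    exact this
  set p : Polynomial ℂ := chartT (genL a b d e f) with hp
  set p' : Polynomial ℂ := chartT (genL (σ a) (σ b) (σ d) (σ e) (σ f)) with hp'
  have h3 : Polynomial.C (σ c) * p' ^ 3 = Polynomial.C c * p ^ 3 := by
    have h1 := congrArg chartT hconj
    rw [chartT_mul, chartT_C, chartT_genB, chartT_mul, chartT_C, chartT_genB, ← hp, ← hp'] at h1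
    have h2 : Polynomial.C (77 : ℂ) * (Polynomial.C (σ c) * p' ^ 3 - Polynomial.C c * p ^ 3) = 0 := by
      linear_combination -h1
    exact sub_eq_zero.mp ((mul_eq_zero.mp h2).resolve_left (Polynomial.C_ne_zero.mpr (by norm_num)))
  have h4 : Polynomial.C (σ c') * p' ^ 4 = Polynomial.C c' * p ^ 4 := by
    have h1 := congrArg chartT hconj'
    rw [chartT_mul, chartT_C, chartT_genC, chartT_mul, chartT_C, chartT_genC, ← hp, ← hp'] at h1
    have h2 : Polynomial.C (2145 : ℂ) * (Polynomial.C (σ c') * p' ^ 4 - Polynomial.C c' * p ^ 4) = 0 := by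
      linear_combination -h1
    exact sub_eq_zero.mp ((mul_eq_zero.mp h2).resolve_left (Polynomial.C_ne_zero.mpr (by norm_num)))
  -- trivial case `Q = 0`
  by_cases hz : a = 0 ∧ b = 0 ∧ d = 0 ∧ e = 0 ∧ f = 0
  · obtain ⟨rfl, rfl, rfl, rfl, rfl⟩ := hz
    exact ⟨1, 0, 0, 0, 0, 0, by simp, by simp, by simp, by simp, by simp⟩
  have hp0 : p ≠ 0 := by
    intro h0
    have hL : genL a b d e f = 0 := eq_zero_of_chartT_eq_zero (isHomogeneous_genL _ _ _ _ _) (lapP_genL _ _ _ _ _) (hp ▸ h0)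
    exact hz (gen_eq_zero_of_genL_eq_zero hL)
  -- `p' = u · p`, `u = (c' σc) / (c σc')`
  set u : ℂ := (c' * σ c) / (c * σ c') with hu
  have hp'u : p' = Polynomial.C u * p := by
    -- `σc' · p'⁴ = c' p⁴` and `p' · (σc · p'³) = p' · c · p³` ⇒ `σc · c' · p⁴ = c · σc' · p' · p³`
    have e1 : Polynomial.C (σ c * c') * p ^ 4 = Polynomial.C (c * σ c') * p' * p ^ 3 := by
      rw [Polynomial.C_mul, Polynomial.C_mul]
      linear_combination (-Polynomial.C (σ c)) * h4 + (Polynomial.C (σ c') * p') * h3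
    have e2 : p ^ 3 * (Polynomial.C (σ c * c') * p - Polynomial.C (c * σ c') * p') = 0 := by linear_combination e1
    have e3 := (mul_eq_zero.mp e2).resolve_left (pow_ne_zero 3 hp0)
    have hcc : c * σ c' ≠ 0 := mul_ne_zero hc ((map_ne_zero σ).mpr hc')
    have : p' = Polynomial.C ((c * σ c')⁻¹) * (Polynomial.C (c * σ c') * p') := by
      rw [← mul_assoc, ← Polynomial.C_mul, inv_mul_cancel₀ hcc, Polynomial.C_1, one_mul]
    rw [this, ← sub_eq_zero.mp e3, ← mul_assoc, ← Polynomial.C_mul, hu]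
    congr 2
    field_simp
  -- injectivity: `L_{σQ} = u L_Q`, componentwise
  have hcomp : σ a = u * a ∧ σ b = u * b ∧ σ d = u * d ∧ σ e = u * e ∧ σ f = u * f := by
    have h0 : genL (σ a - u * a) (σ b - u * b) (σ d - u * d) (σ e - u * e) (σ f - u * f) = 0 := by
      refine eq_zero_of_chartT_eq_zero (isHomogeneous_genL _ _ _ _ _) (lapP_genL _ _ _ _ _) ?_
      rw [genL_sub, genL_smul, chartT_sub, chartT_mul, chartT_C, ← hp, ← hp', hp'u, sub_self]
    obtain ⟨h1, h2, h3', h4', h5⟩ := gen_eq_zero_of_genL_eq_zero h0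
    exact ⟨sub_eq_zero.mp h1, sub_eq_zero.mp h2, sub_eq_zero.mp h3', sub_eq_zero.mp h4', sub_eq_zero.mp h5⟩
  -- `|u| = 1`, square root `w`, and `w · z` real
  have hunit : ‖u‖ = 1 := by
    obtain ⟨z, hz0, hzσ⟩ : ∃ z : ℂ, z ≠ 0 ∧ σ z = u * z := by
      simp only [not_and_or] at hz
      rcases hz with h1 | h1 | h1 | h1 | h1
      · exact ⟨a, h1, hcomp.1⟩
      · exact ⟨b, h1, hcomp.2.1⟩
      · exact ⟨d, h1, hcomp.2.2.1⟩
      · exact ⟨e, h1, hcomp.2.2.2.1⟩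
      · exact ⟨f, h1, hcomp.2.2.2.2⟩
    have h1 := congrArg (fun t : ℂ => ‖t‖) hzσ
    simp only [norm_mul, hσ, Complex.norm_conj] at h1
    have hz' : ‖z‖ ≠ 0 := norm_ne_zero_iff.mpr hz0
    field_simp at h1
    linarith [h1]
  obtain ⟨w, hw⟩ := IsAlgClosed.exists_pow_nat_eq u (by norm_num : 0 < 2)
  have hwunit : ‖w‖ = 1 := by
    have h1 := congrArg (fun t : ℂ => ‖t‖) hw
    simp only [norm_pow, hunit] at h1
    nlinarith [norm_nonneg w, h1]
  have hw0 : w ≠ 0 := fun h0 => by rw [h0, norm_zero] at hwunit; exact zero_ne_one hwunit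
  have hwσ : σ w * w = 1 := by
    rw [hσ, mul_comm, Complex.mul_conj, Complex.normSq_eq_norm_sq, hwunit]; simp
  have hreal : ∀ z : ℂ, σ z = u * z → ∃ r : ℝ, z = w⁻¹ * r := by
    intro z hzσ
    refine ⟨(w * z).re, ?_⟩
    have hfix : σ (w * z) = w * z := by
      rw [map_mul, hzσ, ← hw]
      linear_combination (w * z) * hwσ
    have hre : ((w * z).re : ℂ) = w * z := Complex.conj_eq_iff_re.mp hfix
    rw [hre, ← mul_assoc, inv_mul_cancel₀ hw0, one_mul]
  obtain ⟨ra, hra⟩ := hreal a hcomp.1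
  obtain ⟨rb, hrb⟩ := hreal b hcomp.2.1
  obtain ⟨rd, hrd⟩ := hreal d hcomp.2.2.1
  obtain ⟨re', hre'⟩ := hreal e hcomp.2.2.2.1
  obtain ⟨rf, hrf⟩ := hreal f hcomp.2.2.2.2
  exact ⟨w⁻¹, ra, rb, rd, re', rf, hra, hrb, hrd, hre', hrf⟩

end Summit.NavierStokesRegularity.NavierStokesRegularity.Theorems.PoloidalLiouville.HorizonTower.Zonal

end
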